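import Mathlib.Analysis.Calculus.ContDiff.Basic
import Mathlib.Analysis.Calculus.Deriv.Comp
import Mathlib.Analysis.Calculus.Deriv.Add
import Mathlib.Analysis.Calculus.Deriv.Mul
import Mathlib.MeasureTheory.Integral.IntervalIntegral.FundThmCalculus
import Mathlib.MeasureTheory.Integral.MeanInequalities
import Mathlib.MeasureTheory.Integral.Average
import Mathlib.MeasureTheory.Measure.Lebesgue.EqHaar
import Mathlib.MeasureTheory.Measure.Prod
import Mathlib.MeasureTheory.Group.LIntegral
import HarnessLib

/-!
# The Poincaré–Wirtinger inequality on convex sets of `ℝⁿ` (lintegral form)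

Analysis/FunctionSpaces support file (Sobolev trunk). For a `C¹` map `G : E → F` on a
finite-dimensional real normed space `E` with an additive Haar measure `μ`, and a convex
measurable set `Q` of positive finite measure and diameter `≤ D`,
`∫_Q ‖G - ⨍_Q G‖² ≤ 2ⁿ D² ∫_Q ‖DG‖²`, `n = dim E`
(`lintegral_enorm_sub_setAverage_sq_le`). The constant is not optimal (`D²/π²` is, Payne–Weinberger)
but the proof is the elementary one: `‖G - ⨍_Q G‖²(y) ≤ ⨍_Q ‖G(y) - G(z)‖² dz` (Cauchy–Schwarz),
`‖G(y) - G(z)‖² ≤ D² ∫₀¹ ‖DG(z + τ(y-z))‖² dτ` (fundamental theorem of calculus along the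
segment and Cauchy–Schwarz, `enorm_sub_sq_le_lintegral_fderiv_segment`), and for each `τ` the
double integral `∫_Q∫_Q ‖DG(z + τ(y-z))‖² dy dz` is at most `2ⁿ μ(Q) ∫_Q ‖DG‖²`: writing
`z + τ(y - z) = y + (1-τ)(z - y)` one may assume the coefficient is `≥ ½`, and then the
substitution `w = z + τ(y - z)` (which stays in `Q` by convexity) has Jacobian `τ⁻ⁿ ≤ 2ⁿ`
(`setLIntegral_comp_segment_le`, `setLIntegral_setLIntegral_comp_segment_le`). Everything is
phrased with lower Lebesgue integrals of `‖·‖ₑ²`, so no integrability hypotheses beyond that of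
`G` on `Q` (for the average) are needed.

This is the cellwise inequality behind "`‖f‖_{Ḣ⁻¹} ≤ C h ‖f‖_{L²}` for `f` with zero averages on
cells of size `h`" (`Torus.eHomSobolevSeminorm_neg_one_le_of_cellAverage_eq_zero`,
`TorusCellAverages.lean`).

## References

* L. C. Evans, *Partial Differential Equations*, 2nd ed. (2010), §5.8.1, Thm. 1 (Poincaré's
  inequality on a ball, by the same segment argument).
* D. Gilbarg, N. Trudinger, *Elliptic PDE of Second Order* (2001), (7.45) (Poincaré inequality
  on convex domains).
-/

noncomputable section

open Set Function Filter MeasureTheory MeasureTheory.Measure Module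
open scoped ENNReal NNReal Topology

namespace Literature.Analysis.FunctionSpaces

variable {E : Type*} [NormedAddCommGroup E] [NormedSpace ℝ E] [MeasurableSpace E] [BorelSpace E]
  [FiniteDimensional ℝ E]
variable {F : Type*} [NormedAddCommGroup F] [NormedSpace ℝ F]

/-! ## The segment estimate -/

omit [MeasurableSpace E] [BorelSpace E] [FiniteDimensional ℝ E] in
/-- **Fundamental theorem of calculus along a segment, with Cauchy–Schwarz**: for `G ∈ C¹` and
`‖y - z‖ ≤ D`, `‖G(y) - G(z)‖² ≤ D² ∫₀¹ ‖DG(z + τ(y - z))‖² dτ`. [folklore] -/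
theorem enorm_sub_sq_le_lintegral_fderiv_segment [CompleteSpace F] {G : E → F}
    (hG : ContDiff ℝ 1 G) {D : ℝ} {y z : E} (hyz : ‖y - z‖ ≤ D) :
    ‖G y - G z‖ₑ ^ 2 ≤
      ENNReal.ofReal (D ^ 2) * ∫⁻ τ in Icc (0 : ℝ) 1, ‖fderiv ℝ G (z + τ • (y - z))‖ₑ ^ 2 := by
  have hD : 0 ≤ D := (norm_nonneg _).trans hyz
  -- the path and its derivative
  set γ : ℝ → E := fun τ => z + τ • (y - z) with hγ
  set w : ℝ → F := fun τ => fderiv ℝ G (γ τ) (y - z) with hw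
  have hγd : ∀ τ, HasDerivAt γ (y - z) τ := fun τ => by
    simpa [hγ] using ((hasDerivAt_id τ).smul_const (y - z)).const_add z
  have hderiv : ∀ τ, HasDerivAt (G ∘ γ) (w τ) τ := fun τ =>
    ((hG.differentiable one_ne_zero) (γ τ)).hasFDerivAt.comp_hasDerivAt τ (hγd τ)
  have hwc : Continuous w := by
    have h1 : Continuous fun τ => fderiv ℝ G (γ τ) :=
      (hG.continuous_fderiv one_ne_zero).comp (by fun_prop)
    exact h1.clm_apply continuous_const
  have hftc : ∫ τ in (0 : ℝ)..1, w τ = G y - G z := by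
    have h := intervalIntegral.integral_eq_sub_of_hasDerivAt (fun τ _ => hderiv τ)
      (hwc.intervalIntegrable 0 1)
    simpa [hγ] using h
  -- pointwise bound on the integrand
  have hwb : ∀ τ, ‖w τ‖ₑ ≤ ‖fderiv ℝ G (γ τ)‖ₑ * ENNReal.ofReal D := fun τ => by
    rw [← ofReal_norm, ← ofReal_norm, ← ENNReal.ofReal_mul (norm_nonneg _)]
    exact ENNReal.ofReal_le_ofReal (((fderiv ℝ G (γ τ)).le_opNorm _).trans
      (mul_le_mul_of_nonneg_left hyz (norm_nonneg _)))
  -- Cauchy–Schwarz on `[0,1]`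
  have hmeas : AEMeasurable (fun τ => ‖fderiv ℝ G (γ τ)‖ₑ) (volume.restrict (Icc (0 : ℝ) 1)) :=
    ((hG.continuous_fderiv one_ne_zero).comp (by fun_prop : Continuous γ)).measurable.enorm.aemeasurable
  have hCS : ∫⁻ τ in Icc (0 : ℝ) 1, ‖fderiv ℝ G (γ τ)‖ₑ ≤
      (∫⁻ τ in Icc (0 : ℝ) 1, ‖fderiv ℝ G (γ τ)‖ₑ ^ 2) ^ (1 / 2 : ℝ) := by
    have h := ENNReal.lintegral_mul_le_Lp_mul_Lq (volume.restrict (Icc (0 : ℝ) 1))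
      Real.HolderConjugate.two_two hmeas aemeasurable_const (g := fun _ => 1)
    simp only [Pi.mul_apply, mul_one, lintegral_const, Measure.restrict_apply,
      MeasurableSet.univ, univ_inter, Real.volume_Icc, sub_zero, ENNReal.ofReal_one, mul_one,
      ENNReal.rpow_ofNat] at h
    simpa [one_div] using h
  calc ‖G y - G z‖ₑ ^ 2 = ‖∫ τ in (0 : ℝ)..1, w τ‖ₑ ^ 2 := by rw [hftc]
    _ ≤ (∫⁻ τ in Icc (0 : ℝ) 1, ‖w τ‖ₑ) ^ 2 := by
        gcongr
        rw [intervalIntegral.integral_of_le zero_le_one]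
        exact (enorm_integral_le_lintegral_enorm _).trans (lintegral_mono_set Ioc_subset_Icc_self)
    _ ≤ (∫⁻ τ in Icc (0 : ℝ) 1, ‖fderiv ℝ G (γ τ)‖ₑ * ENNReal.ofReal D) ^ 2 := by
        gcongr with τ
        exact hwb τ
    _ = (∫⁻ τ in Icc (0 : ℝ) 1, ‖fderiv ℝ G (γ τ)‖ₑ) ^ 2 * ENNReal.ofReal (D ^ 2) := by
        rw [lintegral_mul_const'' _ hmeas, mul_pow, ← ENNReal.ofReal_pow hD]
    _ ≤ ((∫⁻ τ in Icc (0 : ℝ) 1, ‖fderiv ℝ G (γ τ)‖ₑ ^ 2) ^ (1 / 2 : ℝ)) ^ 2 *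
          ENNReal.ofReal (D ^ 2) := by gcongr
    _ = ENNReal.ofReal (D ^ 2) * ∫⁻ τ in Icc (0 : ℝ) 1, ‖fderiv ℝ G (z + τ • (y - z))‖ₑ ^ 2 := by
        rw [mul_comm, ← ENNReal.rpow_natCast, ← ENNReal.rpow_mul]
        norm_num
        rfl

/-! ## The scaled-segment substitution -/

section Haar

variable (μ : Measure E) [IsAddHaarMeasure μ]

/-- Lower Lebesgue integrals under a homothety: `∫⁻ H(σ y) dμ = |σ⁻ⁿ| ∫⁻ H dμ` for `σ ≠ 0`
(Mathlib `Measure.map_addHaar_smul`). [folklore] -/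
theorem lintegral_comp_smul (H : E → ℝ≥0∞) {σ : ℝ} (hσ : σ ≠ 0) :
    ∫⁻ y, H (σ • y) ∂μ = ENNReal.ofReal |(σ ^ finrank ℝ E)⁻¹| * ∫⁻ y, H y ∂μ := by
  calc ∫⁻ y, H (σ • y) ∂μ = ∫⁻ y, H y ∂(Measure.map (σ • ·) μ) :=
        (lintegral_map_equiv H
          (Homeomorph.smul (isUnit_iff_ne_zero.2 hσ).unit).toMeasurableEquiv).symm
    _ = _ := by rw [map_addHaar_smul μ hσ, lintegral_smul_measure, smul_eq_mul]

/-- **Substitution along scaled segments.** For a convex measurable `Q`, `z ∈ Q` and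
`½ ≤ σ ≤ 1`: `∫_{y ∈ Q} φ(z + σ(y - z)) dy ≤ 2ⁿ ∫_Q φ` — the points `z + σ(y - z)` stay in `Q`,
and the homothety of ratio `σ` has Jacobian `σ⁻ⁿ ≤ 2ⁿ`. [folklore] -/
theorem setLIntegral_comp_segment_le (φ : E → ℝ≥0∞) {Q : Set E}
    (hQ : Convex ℝ Q) (hQm : MeasurableSet Q) {z : E} (hz : z ∈ Q) {σ : ℝ} (hσ : 1 / 2 ≤ σ)
    (hσ1 : σ ≤ 1) :
    ∫⁻ y in Q, φ (z + σ • (y - z)) ∂μ ≤ ENNReal.ofReal (2 ^ finrank ℝ E) * ∫⁻ w in Q, φ w ∂μ := by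
  have hσ0 : 0 < σ := by linarith
  set ψ : E → ℝ≥0∞ := Q.indicator φ with hψ
  -- pointwise: `1_Q(y) φ(z + σ(y-z)) ≤ ψ (z + σ(y-z))` (convexity)
  have hpt : ∀ y, Q.indicator (fun y => φ (z + σ • (y - z))) y ≤ ψ (z + σ • (y - z)) := by
    intro y
    by_cases hy : y ∈ Q
    · have hw : z + σ • (y - z) ∈ Q := by
        have h := hQ hz hy (by linarith : (0 : ℝ) ≤ 1 - σ) hσ0.le (by ring)
        convert h using 1
        module
      simp [hψ, indicator_of_mem hy, indicator_of_mem hw]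
    · simp [indicator_of_notMem hy]
  have hshift : ∀ y : E, z + σ • (y - z) = σ • y + (z - σ • z) := fun y => by module
  calc ∫⁻ y in Q, φ (z + σ • (y - z)) ∂μ
      = ∫⁻ y, Q.indicator (fun y => φ (z + σ • (y - z))) y ∂μ := (lintegral_indicator hQm _).symm
    _ ≤ ∫⁻ y, ψ (z + σ • (y - z)) ∂μ := lintegral_mono hpt
    _ = ∫⁻ y, (fun u => ψ (u + (z - σ • z))) (σ • y) ∂μ := by simp_rw [hshift]
    _ = ENNReal.ofReal |(σ ^ finrank ℝ E)⁻¹| * ∫⁻ u, ψ (u + (z - σ • z)) ∂μ :=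
        lintegral_comp_smul μ (fun u => ψ (u + (z - σ • z))) hσ0.ne'
    _ = ENNReal.ofReal |(σ ^ finrank ℝ E)⁻¹| * ∫⁻ u, ψ u ∂μ := by rw [lintegral_add_right_eq_self]
    _ = ENNReal.ofReal |(σ ^ finrank ℝ E)⁻¹| * ∫⁻ w in Q, φ w ∂μ := by rw [hψ, lintegral_indicator hQm]
    _ ≤ ENNReal.ofReal (2 ^ finrank ℝ E) * ∫⁻ w in Q, φ w ∂μ := by
        gcongr
        rw [abs_of_pos (inv_pos.2 (pow_pos hσ0 _)), ← inv_pow]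
        refine pow_le_pow_left₀ (inv_nonneg.2 hσ0.le) ?_ _
        rw [inv_le_comm₀ hσ0 two_pos]
        linarith

/-- **The double integral along segments.** For a convex measurable `Q` and every `τ ∈ [0,1]`:
`∫_{z∈Q} ∫_{y∈Q} φ(z + τ(y - z)) dy dz ≤ 2ⁿ μ(Q) ∫_Q φ`. For `τ ≥ ½` this is the previous
lemma integrated in `z`; for `τ < ½` one first swaps the integrals (Tonelli) and writes
`z + τ(y - z) = y + (1-τ)(z - y)`. [folklore] -/
theorem setLIntegral_setLIntegral_comp_segment_le {φ : E → ℝ≥0∞} (hφ : Measurable φ) {Q : Set E}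
    (hQ : Convex ℝ Q) (hQm : MeasurableSet Q) {τ : ℝ} (hτ0 : 0 ≤ τ) (hτ1 : τ ≤ 1) :
    ∫⁻ z in Q, ∫⁻ y in Q, φ (z + τ • (y - z)) ∂μ ∂μ ≤
      ENNReal.ofReal (2 ^ finrank ℝ E) * μ Q * ∫⁻ w in Q, φ w ∂μ := by
  rcases le_or_gt (1 / 2 : ℝ) τ with hτ | hτ
  · calc ∫⁻ z in Q, ∫⁻ y in Q, φ (z + τ • (y - z)) ∂μ ∂μ
        ≤ ∫⁻ z in Q, ENNReal.ofReal (2 ^ finrank ℝ E) * ∫⁻ w in Q, φ w ∂μ ∂μ :=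
          setLIntegral_mono' hQm fun z hz => setLIntegral_comp_segment_le μ φ hQ hQm hz hτ hτ1
      _ = _ := by rw [setLIntegral_const]; ring
  · have hmeas : Measurable (uncurry fun z y : E => φ (z + τ • (y - z))) :=
      hφ.comp (measurable_fst.add ((measurable_snd.sub measurable_fst).const_smul τ))
    rw [lintegral_lintegral_swap hmeas.aemeasurable]
    have heq : ∀ y z : E, z + τ • (y - z) = y + (1 - τ) • (z - y) := fun y z => by module
    simp_rw [heq]
    calc ∫⁻ y in Q, ∫⁻ z in Q, φ (y + (1 - τ) • (z - y)) ∂μ ∂μ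
        ≤ ∫⁻ y in Q, ENNReal.ofReal (2 ^ finrank ℝ E) * ∫⁻ w in Q, φ w ∂μ ∂μ :=
          setLIntegral_mono' hQm fun y hy =>
            setLIntegral_comp_segment_le μ φ hQ hQm hy (by linarith) (by linarith)
      _ = _ := by rw [setLIntegral_const]; ring

end Haar

/-! ## Deviation from the average -/

section Average

variable {α : Type*} [MeasurableSpace α] (μ : Measure α) [CompleteSpace F]

/-- **Deviation from the average, pointwise (Cauchy–Schwarz).** For `G` integrable on a set `Q`
of positive finite measure: `‖G(y) - ⨍_Q G‖² ≤ μ(Q)⁻¹ ∫_{z ∈ Q} ‖G(y) - G(z)‖²`. [folklore] -/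
theorem enorm_sub_setAverage_sq_le {G : α → F} {Q : Set α} (hQ0 : μ Q ≠ 0) (hQt : μ Q ≠ ∞)
    (hGi : IntegrableOn G Q μ) (hGm : AEStronglyMeasurable G μ) (y : α) :
    ‖G y - ⨍ z in Q, G z ∂μ‖ₑ ^ 2 ≤ (μ Q)⁻¹ * ∫⁻ z in Q, ‖G y - G z‖ₑ ^ 2 ∂μ := by
  have hreal : 0 < μ.real Q := ENNReal.toReal_pos hQ0 hQt
  -- `G y - ⨍ G = (μ.real Q)⁻¹ • ∫_Q (G y - G z) dz`
  have hconst : IntegrableOn (fun _ : α => G y) Q μ := integrableOn_const (C := G y) hQt (by simp)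
  have hsub : ∫ z in Q, (G y - G z) ∂μ = (μ.real Q) • G y - ∫ z in Q, G z ∂μ := by
    rw [integral_sub hconst hGi, setIntegral_const]
  have hdev : G y - ⨍ z in Q, G z ∂μ = (μ.real Q)⁻¹ • ∫ z in Q, (G y - G z) ∂μ := by
    rw [hsub, smul_sub, smul_smul, inv_mul_cancel₀ hreal.ne', one_smul, setAverage_eq]
  -- Cauchy–Schwarz on `Q`
  have hmeas : AEMeasurable (fun z => ‖G y - G z‖ₑ) (μ.restrict Q) :=
    (aestronglyMeasurable_const.sub hGm.restrict).enorm
  have hCS : ∫⁻ z in Q, ‖G y - G z‖ₑ ∂μ ≤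
      (∫⁻ z in Q, ‖G y - G z‖ₑ ^ 2 ∂μ) ^ (1 / 2 : ℝ) * (μ Q) ^ (1 / 2 : ℝ) := by
    have h := ENNReal.lintegral_mul_le_Lp_mul_Lq (μ.restrict Q) Real.HolderConjugate.two_two
      hmeas aemeasurable_const (g := fun _ => 1)
    simp only [Pi.mul_apply, mul_one, lintegral_const, Measure.restrict_apply,
      MeasurableSet.univ, univ_inter, ENNReal.rpow_ofNat] at h
    simpa [one_div] using h
  have hinv : ‖(μ.real Q)⁻¹‖ₑ = (μ Q)⁻¹ := by
    rw [Real.enorm_eq_ofReal (inv_nonneg.2 hreal.le), ENNReal.ofReal_inv_of_pos hreal,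
      ofReal_measureReal]
  calc ‖G y - ⨍ z in Q, G z ∂μ‖ₑ ^ 2
      = ((μ Q)⁻¹ * ‖∫ z in Q, (G y - G z) ∂μ‖ₑ) ^ 2 := by rw [hdev, enorm_smul, hinv]
    _ ≤ ((μ Q)⁻¹ * ∫⁻ z in Q, ‖G y - G z‖ₑ ∂μ) ^ 2 := by
        gcongr; exact enorm_integral_le_lintegral_enorm _
    _ ≤ ((μ Q)⁻¹ * ((∫⁻ z in Q, ‖G y - G z‖ₑ ^ 2 ∂μ) ^ (1 / 2 : ℝ) * (μ Q) ^ (1 / 2 : ℝ))) ^ 2 := by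
        gcongr
    _ = (μ Q)⁻¹ * ∫⁻ z in Q, ‖G y - G z‖ₑ ^ 2 ∂μ := by
        rw [mul_pow, mul_pow, ← ENNReal.rpow_natCast ((∫⁻ z in Q, ‖G y - G z‖ₑ ^ 2 ∂μ) ^ _),
          ← ENNReal.rpow_natCast ((μ Q) ^ _), ← ENNReal.rpow_mul, ← ENNReal.rpow_mul]
        norm_num
        rw [mul_comm ((∫⁻ z in Q, ‖G y - G z‖ₑ ^ 2 ∂μ)) (μ Q), ← mul_assoc, pow_two,
          mul_assoc (μ Q)⁻¹, ENNReal.inv_mul_cancel hQ0 hQt, mul_one]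

end Average

/-! ## The Poincaré–Wirtinger inequality -/

section PW

variable (μ : Measure E) [IsAddHaarMeasure μ] [CompleteSpace F]

/-- **Poincaré–Wirtinger inequality on a convex set** (lintegral form, non-optimal constant):
for `G ∈ C¹(E; F)` integrable on a convex measurable `Q ⊆ E` of positive finite measure and
diameter `≤ D`,
`∫_Q ‖G - ⨍_Q G‖² dμ ≤ 2ⁿ D² ∫_Q ‖DG‖² dμ`, `n = dim E`
(Evans 2010, §5.8.1, Thm. 1, for balls; Gilbarg–Trudinger (7.45) for convex domains — both with
the segment argument used here). [cite: Evans2010, §5.8.1 Thm. 1] -/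
theorem lintegral_enorm_sub_setAverage_sq_le {G : E → F} (hG : ContDiff ℝ 1 G) {Q : Set E}
    (hQ : Convex ℝ Q) (hQm : MeasurableSet Q) (hQ0 : μ Q ≠ 0) (hQt : μ Q ≠ ∞)
    (hGi : IntegrableOn G Q μ) {D : ℝ} (hD : ∀ y ∈ Q, ∀ z ∈ Q, ‖y - z‖ ≤ D) :
    ∫⁻ y in Q, ‖G y - ⨍ z in Q, G z ∂μ‖ₑ ^ 2 ∂μ ≤
      ENNReal.ofReal (2 ^ finrank ℝ E * D ^ 2) * ∫⁻ y in Q, ‖fderiv ℝ G y‖ₑ ^ 2 ∂μ := by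
  set φ : E → ℝ≥0∞ := fun w => ‖fderiv ℝ G w‖ₑ ^ 2 with hφ
  have hφm : Measurable φ := (hG.continuous_fderiv one_ne_zero).measurable.enorm.pow_const _
  have hGc : Continuous G := hG.continuous
  -- Step 1: Cauchy–Schwarz against the average, integrated over `y ∈ Q`
  have h1 : ∫⁻ y in Q, ‖G y - ⨍ z in Q, G z ∂μ‖ₑ ^ 2 ∂μ ≤
      (μ Q)⁻¹ * ∫⁻ y in Q, ∫⁻ z in Q, ‖G y - G z‖ₑ ^ 2 ∂μ ∂μ := by
    rw [← lintegral_const_mul' _ _ (ENNReal.inv_ne_top.2 hQ0)]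
    exact lintegral_mono fun y =>
      enorm_sub_setAverage_sq_le μ hQ0 hQt hGi hGc.aestronglyMeasurable y
  -- Step 2: the segment estimate, for `y, z ∈ Q`
  have h2 : ∫⁻ y in Q, ∫⁻ z in Q, ‖G y - G z‖ₑ ^ 2 ∂μ ∂μ ≤
      ∫⁻ y in Q, (∫⁻ z in Q, (ENNReal.ofReal (D ^ 2) *
        ∫⁻ τ in Icc (0 : ℝ) 1, φ (z + τ • (y - z))) ∂μ) ∂μ :=
    setLIntegral_mono' hQm fun y hy => setLIntegral_mono' hQm fun z hz =>
      enorm_sub_sq_le_lintegral_fderiv_segment hG (hD y hy z hz)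
  -- Step 3: move the `τ` integral out (Tonelli) and bound each `τ`-slice
  have hmeasI : ∀ y : E, Measurable (uncurry fun (z : E) (τ : ℝ) => φ (z + τ • (y - z))) :=
    fun y => hφm.comp (by fun_prop)
  have hmeasO : Measurable (uncurry fun (p : E × ℝ) (z : E) => φ (z + p.2 • (p.1 - z))) :=
    hφm.comp (by fun_prop)
  have hin : ∀ y, ∫⁻ z in Q, (ENNReal.ofReal (D ^ 2) *
      ∫⁻ τ in Icc (0 : ℝ) 1, φ (z + τ • (y - z))) ∂μ =
      ENNReal.ofReal (D ^ 2) * ∫⁻ τ in Icc (0 : ℝ) 1, (∫⁻ z in Q, φ (z + τ • (y - z)) ∂μ) := by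
    intro y
    rw [lintegral_const_mul' _ _ ENNReal.ofReal_ne_top, lintegral_lintegral_swap (hmeasI y).aemeasurable]
  have hout : Measurable fun p : E × ℝ => ∫⁻ z in Q, φ (z + p.2 • (p.1 - z)) ∂μ :=
    hmeasO.lintegral_prod_right
  have h3 : ∫⁻ y in Q, (∫⁻ z in Q, (ENNReal.ofReal (D ^ 2) *
        ∫⁻ τ in Icc (0 : ℝ) 1, φ (z + τ • (y - z))) ∂μ) ∂μ =
      ENNReal.ofReal (D ^ 2) * ∫⁻ τ in Icc (0 : ℝ) 1,
        (∫⁻ y in Q, ∫⁻ z in Q, φ (z + τ • (y - z)) ∂μ ∂μ) := by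
    rw [lintegral_congr fun y => hin y, lintegral_const_mul' _ _ ENNReal.ofReal_ne_top,
      lintegral_lintegral_swap hout.aemeasurable]
  have h4 : ∫⁻ τ in Icc (0 : ℝ) 1, (∫⁻ y in Q, ∫⁻ z in Q, φ (z + τ • (y - z)) ∂μ ∂μ) ≤
      ENNReal.ofReal (2 ^ finrank ℝ E) * μ Q * ∫⁻ w in Q, φ w ∂μ := by
    have heq : ∀ (τ : ℝ) (y z : E), z + τ • (y - z) = y + (1 - τ) • (z - y) := fun τ y z => by module
    calc ∫⁻ τ in Icc (0 : ℝ) 1, (∫⁻ y in Q, ∫⁻ z in Q, φ (z + τ • (y - z)) ∂μ ∂μ)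
        ≤ ∫⁻ τ in Icc (0 : ℝ) 1, (ENNReal.ofReal (2 ^ finrank ℝ E) * μ Q * ∫⁻ w in Q, φ w ∂μ) := by
          refine setLIntegral_mono' measurableSet_Icc fun τ hτ => ?_
          simp_rw [heq τ]
          exact setLIntegral_setLIntegral_comp_segment_le μ hφm hQ hQm
            (by linarith [hτ.2]) (by linarith [hτ.1])
      _ = _ := by rw [setLIntegral_const, Real.volume_Icc]; simp
  -- assemble
  calc ∫⁻ y in Q, ‖G y - ⨍ z in Q, G z ∂μ‖ₑ ^ 2 ∂μ
      ≤ (μ Q)⁻¹ * (ENNReal.ofReal (D ^ 2) * (ENNReal.ofReal (2 ^ finrank ℝ E) * μ Q *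
          ∫⁻ w in Q, φ w ∂μ)) := by
        refine h1.trans ?_
        gcongr
        exact h2.trans (h3.le.trans (by gcongr))
    _ = ENNReal.ofReal (2 ^ finrank ℝ E * D ^ 2) * ∫⁻ y in Q, ‖fderiv ℝ G y‖ₑ ^ 2 ∂μ := by
        rw [ENNReal.ofReal_mul (by positivity), hφ]
        calc (μ Q)⁻¹ * (ENNReal.ofReal (D ^ 2) * (ENNReal.ofReal (2 ^ finrank ℝ E) * μ Q *
              ∫⁻ w in Q, ‖fderiv ℝ G w‖ₑ ^ 2 ∂μ))
            = ((μ Q)⁻¹ * μ Q) * (ENNReal.ofReal (2 ^ finrank ℝ E) * ENNReal.ofReal (D ^ 2) *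
              ∫⁻ w in Q, ‖fderiv ℝ G w‖ₑ ^ 2 ∂μ) := by ring
          _ = _ := by rw [ENNReal.inv_mul_cancel hQ0 hQt, one_mul]

end PW

end Literature.Analysis.FunctionSpaces

end
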